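import Summits.ABC.ABC.Theses.DefiniteXi
import Summits.ABC.ABC.Theorems.IsogenyGlueCongruenceMazurKenkuBoundOfEightTables
import Literature.NumberTheory.EllipticCurves.PastenHeightBoundsLemma68LocalProofs
import Literature.NumberTheory.EllipticCurves.OpenImageMazurInputsProofs
import Literature.NumberTheory.EllipticCurves.MazurTorsionPrimeCaseFromCor44Proofs
import Literature.NumberTheory.EllipticCurves.SemistableModPImageProofs
import Literature.NumberTheory.EllipticCurves.RationalTwoTorsionSemistableModPIrreducibleProofs
import Literature.NumberTheory.EllipticCurves.MazurTorsion
import HarnessLib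

/-!
# Stub ideas k3 / gen 15 for `stub_pastenLemma68` — FAMILY 3 (probe the extremes):
# "three doors by SOURCE CLASS" through one per-source radius funnel

Companion to `STUB-IDEAS-stub_pastenLemma68-3.md` (crux `DefiniteRTControlPrime`, stmt-ABC-11338,
route `DefiniteXi`).  The stub `PastenShimura2024_lemma_6_8` quantifies over a SOURCE curve `W`
with a multiplicative place; Mazur's Theorem 1 is only ever needed FOR THAT SOURCE.  Splitting the
sources by the `j`-profile at the odd places gives three doors, each with a strictly smaller bill
than the global radius (`h44 + hT8 + hL6`, Plan A of gens 10–14):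

* §A  the funnel (PROVED): per-source prime support ⊆ `S` ⇒ per-source radius `R` ⇒ Lemma 6.8 at
      EVERY multiplicative place of the source (incl. `v = 2`) with constant `R ≤ 163`;
* §B  door D1, `j(W) ∈ ℤ[1/2]` (PROVED, NEW): Mazur's Thm 1 for such `W` WITHOUT Cor. 4.4
      (`hasIrreducibleModPGaloisRep_of_oddIntegral_j`) ⇒ Lemma 6.8 for these sources from the
      tables `hT + hL6` alone;
* §C  door D3, `j(W)` has an odd pole (PROVED): Cor. 4.4 in contradiction form ⇒ support ⊆
      `{2,3,5,7,13}` ⇒ radius 163 from row 27 + six levels + Klein–Fricke at 7 — NO big tables;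
* §D  door D2, `W` semistable (PROVED): Serre's dichotomy (`Edixhoven1997_prop_2_1_holds`) +
      the named fact Mazur 1977 (`Mazur1977_no_prime_torsion`, hypothesis) ⇒ support ⊆
      `{2,3,5,7,13}` ⇒ Lemma 6.8 for semistable sources with NO Cor. 4.4 and NO big tables;
* §E  the `{2,3,5,7,13}`-smooth barrier: coverage certificate PROVED (`decide +kernel`), the
      exclusion `smooth_hexcl` PROVED from row 27 + six levels + Klein–Fricke at 7 (no big tables),
      the level-27 / integral-row exclusions for multiplicative sources PROVED;
* §F  assembly: the verbatim stub from `h44 + hT8 + hL6` by the D1/D3 dichotomy, and the two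
      cheaper corollaries.

NO sorries (`lean check` rc 0, 0 sorries, 2026-09-01).  Remaining printed inputs appear only as
HYPOTHESES: `h44` (Cor. 4.4, stmt-ABC-18223), the `j`-tables, the six levels, Mazur 1977, and
Klein–Fricke at 7 (`KleinSeven`, discharged in the tree by `stub_kleinSevenRat`).
-/

noncomputable section

set_option linter.dupNamespace false

open scoped Classical NumberField
open NumberField IsDedekindDomain IsDedekindDomain.HeightOneSpectrum Field WeierstrassCurve
open Literature.NumberTheory.EllipticCurves Literature.NumberTheory.EllipticCurves.ModularForms
open Literature.NumberTheory.EllipticCurves.Mazur1978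
open Literature.NumberTheory.GaloisRepresentations
open Summit.ABC.ABC.Theorems

namespace Summit.ABC.ABC.Cruxes.DefiniteRTControlPrime.StubIdeas3G15

/-! ### Abbreviations for the printed inputs and the source classes -/

/-- The ten `j`-tables (schema of `lite_hexcl`). -/
def TenTables : Prop :=
  ∀ (V V' : WeierstrassCurve ℚ) [V.IsElliptic] [V'.IsElliptic] (ψ : Isogeny V V'),
    ψ.IsCyclic → ψ.degree ∈ ({11, 15, 17, 19, 21, 27, 37, 43, 67, 163} : Finset ℕ) →
      (ψ.degree, V.j) ∈ kenkuIsogenyJTable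

/-- The eight `j`-tables (`hT8` of `stub_of_eight`). -/
def EightTables : Prop :=
  ∀ (V V' : WeierstrassCurve ℚ) [V.IsElliptic] [V'.IsElliptic] (ψ : Isogeny V V'),
    ψ.IsCyclic → ψ.degree ∈ ({11, 17, 19, 27, 37, 43, 67, 163} : Finset ℕ) →
      (ψ.degree, V.j) ∈ kenkuIsogenyJTable

/-- The six smooth Kenku levels (`hL6`). -/
def SixLevels : Prop :=
  ∀ (V V' : WeierstrassCurve ℚ) [V.IsElliptic] [V'.IsElliptic] (ψ : Isogeny V V'),
    ψ.IsCyclic → ψ.degree ∉ ({26, 35, 49, 65, 125, 169} : Finset ℕ)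

/-- Row 27 of Kenku's table alone: a cyclic `27`-isogeny forces `j = -2¹⁵·3·5³`. -/
def RowTwentySeven : Prop :=
  ∀ (V V' : WeierstrassCurve ℚ) [V.IsElliptic] [V'.IsElliptic] (ψ : Isogeny V V'),
    ψ.IsCyclic → ψ.degree = 27 → V.j = -12288000

/-- Mazur 1977 (no rational `p`-torsion for `p ∉ {2,3,5,7}`; the tree's named fact, `13` kept). -/
def NoPrimeTorsion : Prop := ∀ V : WeierstrassCurve ℚ, Mazur1977_no_prime_torsion V

/-- Source class D1: `j(W) ∈ ℤ[1/2]` (integral at every odd place). -/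
def OddIntegralJ (W : WeierstrassCurve ℚ) [W.IsElliptic] : Prop :=
  ∀ v : HeightOneSpectrum (𝓞 ℚ), (2 : 𝓞 ℚ) ∉ v.asIdeal → v.valuation ℚ W.j ≤ 1

/-- Source class D3: `j(W)` has a pole at an odd place (= `¬ OddIntegralJ W`). -/
def OddPole (W : WeierstrassCurve ℚ) [W.IsElliptic] : Prop :=
  ∃ v : HeightOneSpectrum (𝓞 ℚ), (2 : 𝓞 ℚ) ∉ v.asIdeal ∧ 1 < v.valuation ℚ W.j

theorem oddPole_of_not_oddIntegralJ {W : WeierstrassCurve ℚ} [W.IsElliptic] (h : ¬ OddIntegralJ W) :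
    OddPole W := by
  simp only [OddIntegralJ, not_forall, not_le, exists_prop] at h
  exact h

/-- Lemma 6.8's conclusion FOR THE SOURCE `W`, at every multiplicative place, constant `163`. -/
def Lemma68For (W : WeierstrassCurve ℚ) [W.IsElliptic] : Prop :=
  ∀ (W' : WeierstrassCurve ℚ) [W'.IsElliptic], W.IsIsogenous W' →
    ∀ v : HeightOneSpectrum ℤ, W.HasMultiplicativeReductionAt v →
      ∃ m n : ℕ, 0 < m ∧ m ≤ 163 ∧ 0 < n ∧ n ≤ 163 ∧
        W.ordMinimalDiscriminant v * n = W'.ordMinimalDiscriminant v * m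

theorem stub_of_forall (h : ∀ (W : WeierstrassCurve ℚ) [W.IsElliptic], Lemma68For W) :
    PastenShimura2024_lemma_6_8 :=
  fun W W' _ _ hiso v hv ↦ h W W' hiso v hv

/-! ### §A  The per-source funnel (PROVED) -/

/-- F1 (transport, PROVED): a radius `R ≤ 163` FOR THE SOURCE `W` (needed only when `W` has a
multiplicative place) gives Lemma 6.8 for `W` at every multiplicative place. -/
theorem lemma68For_of_sourceRadius (W : WeierstrassCurve ℚ) [W.IsElliptic] {R : ℕ} (hR : R ≤ 163)
    (hrad : ∀ (W' : WeierstrassCurve ℚ) [W'.IsElliptic], W.IsIsogenous W' →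
      (∃ v : HeightOneSpectrum ℤ, W.HasMultiplicativeReductionAt v) → ∃ φ : Isogeny W W', φ.degree ≤ R) :
    Lemma68For W := by
  intro W' _ hiso v hv
  obtain ⟨φ, hφR⟩ := hrad W' hiso ⟨v, hv⟩
  have hv' : W'.HasMultiplicativeReductionAt v := hasMultiplicativeReductionAt_of_isIsogenous ⟨φ⟩ v hv
  obtain ⟨ψ, hcyc, hdvd⟩ := φ.exists_isCyclic_degree_dvd
  obtain ⟨a, b, ha, hb, hab, h⟩ :=
    exists_ordMinimalDiscriminant_mul_eq_mul_of_isCyclic ψ.degree ψ hcyc rfl v hv hv'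
  have habn : a * b ≤ 163 := ((Nat.le_of_dvd φ.degree_pos (hab.trans hdvd)).trans hφR).trans hR
  refine ⟨a, b, ha, ?_, hb, ?_, h⟩
  · have : a ≤ a * b := Nat.le_mul_of_pos_right a hb
    omega
  · have : b ≤ a * b := Nat.le_mul_of_pos_left b ha
    omega

/-- The elementary step, generic in the radius (copy of the tree's private lemma in
`IsogenyGlueCongruenceMazurKenkuBoundStubRadius`). -/
private theorem exists_dvd_gt_le_sq {R n : ℕ} (hR : 1 ≤ R) (hn : R < n)
    (hp : ∀ p : ℕ, p.Prime → p ∣ n → p ≤ R) :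
    ∃ d, d ∣ n ∧ R < d ∧ d ≤ R * R := by
  have hex : ∃ e, e ∣ n ∧ R < e := ⟨n, dvd_rfl, hn⟩
  refine ⟨Nat.find hex, (Nat.find_spec hex).1, (Nat.find_spec hex).2, ?_⟩
  by_contra hgt
  rw [not_le] at hgt
  obtain ⟨hdn, hd⟩ := Nat.find_spec hex
  obtain ⟨p, hpp, hpd⟩ := Nat.exists_prime_and_dvd (show Nat.find hex ≠ 1 by omega)
  have hple : p ≤ R := hp p hpp (hpd.trans hdn)
  obtain ⟨m, hm⟩ := hpd
  have hmd : m ∣ Nat.find hex := Dvd.intro_left p hm.symm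
  have hmR : R < m := by
    by_contra hmle
    have := Nat.mul_le_mul hple (not_lt.mp hmle)
    omega
  have hmlt : m < Nat.find hex := by
    rw [hm]
    exact lt_mul_of_one_lt_left (by omega) hpp.one_lt
  exact Nat.find_min hex hmlt ⟨hmd.trans hdn, hmR⟩

/-- F2 (per-source radius, PROVED; generic in `R`, the support `S` and the barrier `B`): if every
cyclic `ℚ`-isogeny OUT OF `W` has prime degree-factors in `S ⊆ [1, R]` and degree outside `B`,
and `B` covers the `S`-smooth window `(R, R²]`, then `W` reaches its whole class in degree `≤ R`.
Only the source's isogenies are constrained (the tree's `stub_radius_of_mazur_of_barrier` asks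
the GLOBAL Theorem 1). -/
theorem sourceRadius_of_support {R : ℕ} (hR : 1 ≤ R) (S B : Finset ℕ) (hS : ∀ p ∈ S, p ≤ R)
    (hcov : ∀ d ∈ Finset.Ioc R (R * R), (∀ p ∈ d.primeFactors, p ∈ S) → ∃ b ∈ B, b ∣ d)
    (W : WeierstrassCurve ℚ) [W.IsElliptic]
    (hexcl : ∀ (W'' : WeierstrassCurve ℚ) [W''.IsElliptic] (χ : Isogeny W W''),
      χ.IsCyclic → χ.degree ∉ B)
    (hsupp : ∀ (W'' : WeierstrassCurve ℚ) (ψ : Isogeny W W''), ψ.IsCyclic →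
      ∀ p : ℕ, p.Prime → p ∣ ψ.degree → p ∈ S)
    (W' : WeierstrassCurve ℚ) [W'.IsElliptic] (hiso : W.IsIsogenous W') :
    ∃ φ : Isogeny W W', φ.degree ≤ R := by
  obtain ⟨ψ, hψ⟩ := hiso.exists_isCyclic
  refine ⟨ψ, ?_⟩
  by_contra hlt
  rw [not_le] at hlt
  have hprime : ∀ p : ℕ, p.Prime → p ∣ ψ.degree → p ∈ S := hsupp W' ψ hψ
  obtain ⟨d₁, hd₁n, hlt₁, hle₁⟩ :=
    exists_dvd_gt_le_sq hR hlt fun p hp hpd ↦ hS p (hprime p hp hpd)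
  have hd₁primes : ∀ p ∈ d₁.primeFactors, p ∈ S := fun p hp ↦ by
    obtain ⟨hpp, hpd, -⟩ := Nat.mem_primeFactors.mp hp
    exact hprime p hpp (hpd.trans hd₁n)
  obtain ⟨b, hbB, hbd⟩ := hcov d₁ (Finset.mem_Ioc.mpr ⟨hlt₁, hle₁⟩) hd₁primes
  obtain ⟨W'', hW'', χ, hχ, hχd, -⟩ := ψ.exists_isCyclic_degree_eq_of_dvd hψ (hbd.trans hd₁n)
  haveI := hW''
  exact hexcl W'' χ hχ (hχd ▸ hbB)

/-- F3 (per-source support, PROVED; copy of `mem_mazurPrimes_of_prime_dvd_degree` with Theorem 1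
replaced by irreducibility of `W[p]` for THIS `W` and `mazurPrimes` by any `S`). -/
theorem support_of_irreducible (S : Finset ℕ) (W : WeierstrassCurve ℚ) [W.IsElliptic]
    (hirr : ∀ p : ℕ, p.Prime → p ∉ S → W.HasIrreducibleModPGaloisRep p)
    {W' : WeierstrassCurve ℚ} (φ : Isogeny W W') (hφ : φ.IsCyclic)
    {p : ℕ} (hp : p.Prime) (hpd : p ∣ φ.degree) : p ∈ S := by
  by_contra hnot
  haveI : Fact p.Prime := ⟨hp⟩
  set H : AddSubgroup (geomTorsion W (p : ℤ)) :=
    (φ.toAddMonoidHom.comp (geomTorsion W (p : ℤ)).subtype).ker with hH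
  have hHmem : ∀ P : geomTorsion W (p : ℤ), P ∈ H ↔ φ (P : W.geomPoints) = 0 := fun P ↦ by
    rw [hH, AddMonoidHom.mem_ker]
    rfl
  have hstab : ∀ σ : Field.absoluteGaloisGroup ℚ, ∀ P ∈ H, σ • P ∈ H := fun σ P hP ↦ by
    rw [hHmem] at hP ⊢
    rw [AddSubgroup.torsionBy.coe_smul, φ.map_smul, hP, smul_zero]
  rcases hirr p hp hnot H hstab with hbot | htop
  · -- Cauchy: `ker φ` has an element of order `p`, a non-zero point of `E[p] ∩ ker φ`
    obtain ⟨Q, hQ⟩ := exists_prime_addOrderOf_dvd_card' (G := φ.toAddMonoidHom.ker) p hpd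
    have hQp : p • ((Q : φ.toAddMonoidHom.ker) : W.geomPoints) = 0 := by
      have h := congrArg Subtype.val (addOrderOf_nsmul_eq_zero Q)
      rwa [hQ, AddSubmonoidClass.coe_nsmul] at h
    have hQ0 : ((Q : φ.toAddMonoidHom.ker) : W.geomPoints) ≠ 0 := fun h0 ↦ by
      rw [show Q = 0 from Subtype.ext h0, addOrderOf_zero] at hQ
      exact hp.one_lt.ne hQ
    have hmemH : (⟨(Q : W.geomPoints), AddSubgroup.torsionBy.nsmul_iff.mpr hQp⟩ :
        geomTorsion W (p : ℤ)) ∈ H := (hHmem _).mpr ((AddMonoidHom.mem_ker).mp Q.2)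
    rw [hbot, AddSubgroup.mem_bot] at hmemH
    exact hQ0 (congrArg Subtype.val hmemH)
  · -- `E[p] ≤ ker φ` would make `E[p]` cyclic, but it has exponent `p` and order `p²`
    have hle : geomTorsion W (p : ℤ) ≤ φ.toAddMonoidHom.ker := fun P hP ↦
      (AddMonoidHom.mem_ker).mpr ((hHmem ⟨P, hP⟩).mp (htop ▸ AddSubgroup.mem_top _))
    haveI : IsAddCyclic φ.toAddMonoidHom.ker := hφ
    haveI : IsAddCyclic (geomTorsion W (p : ℤ)) := AddSubgroup.isAddCyclic_of_le hle
    have hdvd : AddMonoid.exponent (geomTorsion W (p : ℤ)) ∣ p :=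
      AddMonoid.exponent_dvd_of_forall_nsmul_eq_zero fun P ↦ AddSubgroup.torsionBy.nsmul P
    rw [IsAddCyclic.exponent_eq_card,
      natCard_geomTorsion_eq_sq W (Nat.cast_ne_zero.mpr hp.ne_zero)] at hdvd
    have h1 := Nat.le_of_dvd hp.pos hdvd
    have h2 := hp.two_le
    nlinarith

/-! ### §B  Door D1 — sources with `j ∈ ℤ[1/2]`: Theorem 1 WITHOUT Cor. 4.4 (PROVED, new) -/

/-- H2 (PROVED): **Mazur's Theorem 1 for a curve whose `j` is integral at every odd place, with
no appeal to Cor. 4.4.**  The tree's assembly `mazur_isogeny_irreducible_of_inputs` uses Cor. 4.4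
exactly once, to get `ord_v(j) ≥ 0` at odd `v` (its `hj`); here that is the HYPOTHESIS, and the
second input (Prop. 5.1 classes at an additive `N`) is the tree's
`prop51_exponent_classes_of_additive_holds`.  Everything else is the printed §7 argument verbatim.
[cite: Mazur1978, Thm 1 (pp. 129–130); §7 proof of Thm. 7.1 (pp. 154–155)] -/
theorem hasIrreducibleModPGaloisRep_of_oddIntegral_j (W : WeierstrassCurve ℚ) [W.IsElliptic]
    (hjW : OddIntegralJ W) (p : ℕ) (hp : p.Prime) (hnot : p ∉ mazurPrimes) :
    W.HasIrreducibleModPGaloisRep p := by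
  haveI := Fact.mk hp
  haveI : NeZero p := ⟨hp.ne_zero⟩
  haveI : NeZero ((p : ℕ) : ℚ) := ⟨by exact_mod_cast hp.ne_zero⟩
  have hgenus := eq_or_le_of_not_mem_mazurPrimes hp hnot
  have hp2 : p ≠ 2 := by rcases hgenus with h | h <;> omega
  -- pass to a global minimal model `W' = C • W`; `j(C • W) = j(W)`
  obtain ⟨C, hCmin⟩ := hasGlobalMinimalModel_rat_holds W
  haveI := hCmin
  rw [← hasIrreducibleModPGaloisRep_smul_iff W C p]
  set W' : WeierstrassCurve ℚ := C • W with hW'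
  haveI : W'.IsElliptic := by rw [hW']; infer_instance
  by_contra hirr
  obtain ⟨Cst, hCst, hcard⟩ := (not_hasIrreducibleModPGaloisRep_iff_exists_natCard_eq W' p).1 hirr
  obtain ⟨P, hP0, hCP⟩ := exists_eq_zmultiples_of_natCard_eq W' p hcard
  have hst : ∀ σ : absoluteGaloisGroup ℚ, σ • P ∈ AddSubgroup.zmultiples P := fun σ ↦ by
    rw [← hCP]; exact hCst σ P (by rw [hCP]; exact AddSubgroup.mem_zmultiples P)
  obtain ⟨r, hr⟩ := exists_isogenyCharacter W' p hP0 hst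
  -- NO Cor. 4.4: `j` is integral at the odd places by hypothesis (`j` is a model invariant)
  have hj : ∀ v : HeightOneSpectrum (𝓞 ℚ), (2 : 𝓞 ℚ) ∉ v.asIdeal → v.valuation ℚ W'.j ≤ 1 := by
    intro v hv
    have hjeq : W'.j = W.j := by
      show (C • W).j = W.j
      simp only [variableChange_j]
    rw [hjeq]
    exact hjW v hv
  obtain ⟨k₀, hk₀I, hk₀⟩ := exists_forall_isogenyCharacter_eq_mul_pow W' p hP0 hr
  have hjN : ∀ v : HeightOneSpectrum (𝓞 ℚ), (p : 𝓞 ℚ) ∈ v.asIdeal → v.valuation ℚ W'.j ≤ 1 :=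
    fun v hv ↦ hj v (two_not_mem_of_natCast_mem hp hp2 hv)
  obtain ⟨k, hk, hnorm⟩ : ∃ k : ℕ, (k ≡ 0 [MOD (p - 1) / 2] ∨ k ≡ 1 [MOD (p - 1) / 2] ∨
      2 * k ≡ 1 [MOD (p - 1) / 2] ∨ 3 * k ≡ 1 [MOD (p - 1) / 2] ∨ 3 * k ≡ 2 [MOD (p - 1) / 2]) ∧
      ∀ σ : absoluteGaloisGroup ℚ, ∃ b : (ZMod p)ˣ, b ^ 12 = 1 ∧
        r σ = b * modNCyclotomicCharacter ℚ p σ ^ k := by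
    by_cases hgoodN : W'.HasGoodReductionAtPrime p
    · have hdvd : (p - 1) / 2 ∣ p - 1 := Nat.div_dvd_of_dvd (by
        rcases hp.eq_two_or_odd with h | h <;> omega)
      refine ⟨k₀, ?_, hk₀⟩
      rcases modEq_zero_or_one_of_hasGoodReductionAtPrime W' p (by omega) hgoodN hP0 hr hk₀I
        with h | h
      · exact Or.inl (h.of_dvd hdvd)
      · exact Or.inr (Or.inl (h.of_dvd hdvd))
    · exact Mazur1978.prop51_exponent_classes_of_additive_holds W' p hgenus hP0 hr hjN hgoodN k₀
        hk₀I hk₀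
  have key : ∀ q : ℕ, q.Prime → q ≠ 2 → q ≠ p →
      (∃ (b : ZMod p) (a : ℤ), b ^ 12 = 1 ∧ a ^ 2 ≤ 4 * q ∧
          b * (q : ZMod p) ^ k + b⁻¹ * ((q : ZMod p) * ((q : ZMod p) ^ k)⁻¹) = a) ∧
      ∃ t : ℤ, t ^ 2 ≤ 4 * q ∧
        (q : ZMod p) ^ (12 * k) + (q : ZMod p) ^ 12 * ((q : ZMod p) ^ (12 * k))⁻¹ =
          (frobTracePow t q 12 : ZMod p) := by
    intro q hq hq2 hqp
    haveI := Fact.mk hq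
    set v : HeightOneSpectrum (𝓞 ℚ) := Rat.HeightOneSpectrum.primesEquiv.symm ⟨q, hq⟩ with hvdef
    have hgen : Rat.HeightOneSpectrum.natGenerator v = q := by
      change ((Rat.HeightOneSpectrum.primesEquiv v : Nat.Primes) : ℕ) = q
      rw [hvdef, Equiv.apply_symm_apply]
    have hv : (q : 𝓞 ℚ) ∈ v.asIdeal := by
      have h := natCast_natGenerator_mem_asIdeal v
      rwa [hgen] at h
    exact congruences_of_valuation_j_le_one W' p hP0 hr hnorm hq hq2 hqp hv
      (hj v (two_not_mem_of_natCast_mem hq hq2 hv))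
  refine hnot (mem_mazurPrimes_of_congruences hgenus hk (fun q hq ↦ ?_) fun q hq hq2 h4q ↦ ?_)
  · simp only [Finset.mem_insert, Finset.mem_singleton] at hq
    rcases hq with rfl | rfl
    · exact (key 3 Nat.prime_three (by norm_num) (by rcases hgenus with h | h <;> omega)).2
    · exact (key 5 (by norm_num) (by norm_num) (by rcases hgenus with h | h <;> omega)).2
  · exact (key q hq hq2 (by omega)).1

/-- Door D1 assembled (PROVED): Lemma 6.8 for every source with `j ∈ ℤ[1/2]`, from the tables
`hT` (ten-table schema) and `hL6` ONLY — no Cor. 4.4 (support `⊆ mazurPrimes` by H2 + F3, radius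
`163` by F2 with the tree's `lite_covers` / `lite_hexcl`, transport F1). -/
theorem lemma68For_of_oddIntegral_j (hT : TenTables) (hL : SixLevels) (W : WeierstrassCurve ℚ)
    [W.IsElliptic] (hjW : OddIntegralJ W) : Lemma68For W :=
  lemma68For_of_sourceRadius W le_rfl fun W' _ hiso _ ↦
    sourceRadius_of_support (by norm_num) mazurPrimes _ (fun p hp ↦ le_of_mem_mazurPrimes hp)
      lite_covers W (fun W'' _ χ hχ ↦ lite_hexcl hT hL W W'' χ hχ)
      (fun W'' ψ hψ p hp hpd ↦ support_of_irreducible mazurPrimes W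
        (hasIrreducibleModPGaloisRep_of_oddIntegral_j W hjW) ψ hψ hp hpd) W' hiso

/-! ### §C  Door D3 — sources with an odd pole of `j`: Cor. 4.4 in contradiction form (PROVED) -/

/-- D3a (PROVED, bridge-free): Cor. 4.4 and an odd pole of `j` make `W[p]` irreducible for every
prime `p ∉ {2,3,5,7,13}` (a stable line of order `p = 11` or `p ≥ 17` would force `j` integral at
the odd places).  Typed on `𝓞 ℚ`-places throughout — no `ℤ ↔ 𝓞 ℚ` place bridge.
[cite: Mazur1978, Cor. 4.4 (p. 145)] -/
theorem irreducible_of_cor44_of_oddPole (h44 : Mazur1978.cor44_valuation_j_le_one)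
    (W : WeierstrassCurve ℚ) [W.IsElliptic] (hW : OddPole W) (p : ℕ) (hp : p.Prime)
    (hpS : p ∉ ({2, 3, 5, 7, 13} : Finset ℕ)) : W.HasIrreducibleModPGaloisRep p := by
  haveI : Fact p.Prime := ⟨hp⟩
  haveI : NeZero ((p : ℕ) : ℚ) := ⟨by exact_mod_cast hp.ne_zero⟩
  by_contra hirr
  obtain ⟨C, hC, hcard⟩ := (not_hasIrreducibleModPGaloisRep_iff_exists_natCard_eq W p).1 hirr
  obtain ⟨v, hv2, hv⟩ := hW
  exact absurd (h44 W p (eq_eleven_or_seventeen_le_of_not_mem hp hpS) ⟨C, hC, hcard⟩ v hv2)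
    (not_le.mpr hv)

/-! ### §E  The `{2,3,5,7,13}`-smooth barrier -/

/-- The smooth barrier (13 levels; `27` replaces `54, 81, 351` of the 75-set). -/
def smoothBarrier : Finset ℕ := {20, 26, 27, 32, 35, 42, 49, 63, 65, 75, 125, 169, 273}

/-- Coverage certificate (PROVED, `decide +kernel`): every `d ∈ (163, 163²]` dividing `2730¹⁵`
(`2730 = 2·3·5·7·13`) has a divisor in `smoothBarrier`. -/
theorem smoothBarrier_covers_core :
    ∀ d ∈ Finset.Ioc 163 (163 * 163), (2730 ^ 15) % d = 0 → ∃ b ∈ smoothBarrier, b ∣ d := by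
  decide +kernel

/-- Coverage in the shape F2 consumes (PROVED). -/
theorem smooth_pow_fifteen_dvd : ∀ p ∈ ({2, 3, 5, 7, 13} : Finset ℕ), p ^ 15 ∣ 2730 ^ 15 := by
  decide +kernel

theorem smoothBarrier_covers :
    ∀ d ∈ Finset.Ioc 163 (163 * 163), (∀ p ∈ d.primeFactors, p ∈ ({2, 3, 5, 7, 13} : Finset ℕ)) →
      ∃ b ∈ smoothBarrier, b ∣ d := by
  intro d hd hsm
  refine smoothBarrier_covers_core d hd (Nat.mod_eq_zero_of_dvd ?_)
  obtain ⟨hd163, hd26569⟩ := Finset.mem_Ioc.mp hd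
  refine (Nat.dvd_iff_prime_pow_dvd_dvd _ _).mpr fun p k hp hpk => ?_
  rcases Nat.eq_zero_or_pos k with rfl | hk
  · exact (pow_zero p).symm ▸ one_dvd _
  have hpd : p ∣ d := (dvd_pow_self p hk.ne').trans hpk
  have hp_mem : p ∈ ({2, 3, 5, 7, 13} : Finset ℕ) :=
    hsm p (Nat.mem_primeFactors.mpr ⟨hp, hpd, by omega⟩)
  have hk15 : k ≤ 15 := by
    have h1 : p ^ k ≤ d := Nat.le_of_dvd (by omega) hpk
    have h2 : 2 ^ k ≤ p ^ k := Nat.pow_le_pow_left hp.two_le k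
    by_contra hk15
    have h3 : 2 ^ 16 ≤ 2 ^ k := Nat.pow_le_pow_right (by norm_num) (by omega)
    norm_num at h3
    omega
  exact (pow_dvd_pow p hk15).trans (smooth_pow_fifteen_dvd p hp_mem)

/-- Row 27 from the eight tables (PROVED, finite check on `kenkuIsogenyJTable`). -/
theorem kenkuIsogenyJTable_twentySeven :
    ∀ r ∈ kenkuIsogenyJTable, r.1 = 27 → r.2 = -12288000 := by
  decide +kernel

theorem rowTwentySeven_of_eightTables (hT8 : EightTables) : RowTwentySeven := by
  intro V V' _ _ ψ hψ h27
  have hmem := hT8 V V' ψ hψ (by rw [h27]; decide)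
  exact kenkuIsogenyJTable_twentySeven _ hmem h27

/-- E27 (PROVED): a source with a multiplicative place has no cyclic `27`-isogeny (row 27 gives an
INTEGRAL `j`, a multiplicative place gives `ord_v(j) < 0`). -/
theorem degree_ne_twentySeven (h27 : RowTwentySeven) (W : WeierstrassCurve ℚ) [W.IsElliptic]
    (hmult : ∃ v : HeightOneSpectrum ℤ, W.HasMultiplicativeReductionAt v)
    {W'' : WeierstrassCurve ℚ} [W''.IsElliptic] (ψ : Isogeny W W'') (hψ : ψ.IsCyclic) :
    ψ.degree ≠ 27 := by
  intro hdeg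
  obtain ⟨v, hv⟩ := hmult
  have h1 := one_lt_valuation_j_of_hasMultiplicativeReductionAt W v hv
  rw [h27 W W'' ψ hψ hdeg] at h1
  have h2 : v.valuation ℚ (((-12288000 : ℤ) : ℚ)) ≤ 1 := by
    simpa using HeightOneSpectrum.valuation_le_one (K := ℚ) v (-12288000 : ℤ)
  push_cast at h2
  exact absurd h1 (not_lt.mpr h2)

/-- The same for every INTEGRAL row of Kenku's table (PROVED): the rows of level
`11, 19, 27, 37, 43, 67, 163` have integer `j` (finite check), so none of these levels divides a
cyclic degree out of a source with a multiplicative place — of the eight big tables only ROW 17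
(`j = -297756989/2, -882216989/131072`) ever fires for a Lemma-6.8 source. -/
theorem kenkuIsogenyJTable_integralRows :
    ∀ r ∈ kenkuIsogenyJTable, r.1 ∈ ({11, 19, 27, 37, 43, 67, 163} : Finset ℕ) →
      (r.2.num : ℚ) = r.2 := by
  decide +kernel

theorem degree_notMem_integralRows (hT8 : EightTables) (W : WeierstrassCurve ℚ) [W.IsElliptic]
    (hmult : ∃ v : HeightOneSpectrum ℤ, W.HasMultiplicativeReductionAt v)
    {W'' : WeierstrassCurve ℚ} [W''.IsElliptic] (ψ : Isogeny W W'') (hψ : ψ.IsCyclic) :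
    ψ.degree ∉ ({11, 19, 27, 37, 43, 67, 163} : Finset ℕ) := by
  intro hmem
  obtain ⟨v, hv⟩ := hmult
  have hsub : ∀ n ∈ ({11, 19, 27, 37, 43, 67, 163} : Finset ℕ),
      n ∈ ({11, 17, 19, 27, 37, 43, 67, 163} : Finset ℕ) := by decide
  have hrow := hT8 W W'' ψ hψ (hsub _ hmem)
  have hint : (W.j.num : ℚ) = W.j := kenkuIsogenyJTable_integralRows _ hrow hmem
  have h1 := one_lt_valuation_j_of_hasMultiplicativeReductionAt W v hv
  rw [← hint] at h1
  have h2 : v.valuation ℚ ((W.j.num : ℤ) : ℚ) ≤ 1 := by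
    simpa using HeightOneSpectrum.valuation_le_one (K := ℚ) v W.j.num
  exact absurd h1 (not_lt.mpr h2)

/-- Klein–Fricke at `7` over `ℚ` (hypothesis shape of `jTables_of_eight`; DISCHARGED in the tree by
`stub_kleinSevenRat`, module `IsogenyGlueCongruenceMazurKenkuBoundStubKleinSevenRat`, `computational`). -/
def KleinSeven : Prop :=
  ∀ (W W' : WeierstrassCurve ℚ) [W.IsElliptic] (φ : Isogeny W W'), φ.degree = 7 →
    ∃ t : ℚ, t ≠ 0 ∧ W.j = (t ^ 2 + 13 * t + 49) * (t ^ 2 + 5 * t + 1) ^ 3 / t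

/-- HB (PROVED, given Klein–Fricke at `7`): every cyclic `ℚ`-isogeny out of a source WITH A
MULTIPLICATIVE PLACE avoids `smoothBarrier`, from row 27 and the six levels only — the smooth
branches of `lite_hexcl` re-assembled WITHOUT the eight big tables: `20, 32, 26, 35, 49, 65, 125,
169` = `liteLevels_of_liteLevels6 hL`; `27` = `degree_ne_twentySeven`; `42 = 2·21` = row 21
(`levelTwentyOne_jTable_of hK7`) + `klein_two_ne_of_check (kleinTwoCheck_table …)`; `63 ⊇ 21, 9`
and `75 ⊇ 15, 25` = `stub_certPrimePower` with rows 21 / 15 (`levelFifteen_jTable`,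
`lite_jTable_primePower`); `273 = 13·21` = `stub_certThirteenComposite` + row 21. -/
theorem smooth_hexcl (h27 : RowTwentySeven) (hL : SixLevels) (hK7 : KleinSeven) :
    ∀ (V V' : WeierstrassCurve ℚ) [V.IsElliptic] [V'.IsElliptic] (φ : Isogeny V V'), φ.IsCyclic →
      (∃ v : HeightOneSpectrum ℤ, V.HasMultiplicativeReductionAt v) → φ.degree ∉ smoothBarrier := by
  intro V V' _ _ φ hφ hmult hmem
  -- the two genus-one rows `15, 21` are THEOREMS (given Klein–Fricke at `7` for row 21)
  have hT1521 : ∀ (U U' : WeierstrassCurve ℚ) [U.IsElliptic] [U'.IsElliptic] (ψ : Isogeny U U'),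
      ψ.IsCyclic → (ψ.degree = 15 ∨ ψ.degree = 21) → (ψ.degree, U.j) ∈ kenkuIsogenyJTable := by
    intro U U' _ _ ψ hψ h
    rcases h with h | h
    · rw [h]; exact levelFifteen_jTable U U' ψ hψ h
    · rw [h]; exact levelTwentyOne_jTable_of hK7 U U' ψ hψ h
  -- a row-`15`/`21` sub-isogeny together with a cyclic sub-isogeny of degree `25`/`9`
  have keyPow : ∀ {L m : ℕ}, (L, m) ∈ ({(21, 9), (15, 25)} : Finset (ℕ × ℕ)) →
      L ∣ φ.degree → m ∣ φ.degree → False := by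
    intro L m hLm hLd hm
    have hL' : ∀ x ∈ ({(21, 9), (15, 25)} : Finset (ℕ × ℕ)),
        (x.1 = 15 ∨ x.1 = 21) ∧ x ∈ ({(21, 9), (15, 25), (27, 81)} : Finset (ℕ × ℕ)) := by decide
    obtain ⟨V₂, hV₂, ψL, hψLc, hψLd, -⟩ := φ.exists_isCyclic_degree_eq_of_dvd hφ (d := L) hLd
    obtain ⟨V₃, hV₃, χ, hχc, hχd, -⟩ := φ.exists_isCyclic_degree_eq_of_dvd hφ (d := m) hm
    haveI := hV₂
    haveI := hV₃
    have hT := hT1521 V V₂ ψL hψLc (by rw [hψLd]; exact (hL' _ hLm).1)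
    rw [hψLd] at hT
    refine stub_certPrimePower V V₃ χ hχc ?_
    rw [hχd]
    exact (lite_jTable_primePower _ hT).2 _ (hL' _ hLm).2 rfl
  have hsplit : ∀ b ∈ smoothBarrier, b ∈ ({20, 26, 32, 35, 49, 65, 125, 169} : Finset ℕ) ∨
      b = 27 ∨ b = 42 ∨ b = 63 ∨ b = 75 ∨ b = 273 := by decide
  rcases hsplit _ hmem with hD | h | h | h | h | h
  · exact liteLevels_of_liteLevels6 hL V V' φ hφ hD
  · exact degree_ne_twentySeven h27 V hmult φ hφ h
  · -- `42 = 2 · 21`: row 21 and the Klein–Fricke check at `2`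
    obtain ⟨t, ht, hj⟩ :=
      φ.exists_j_eq_klein_two_of_two_dvd_degree hφ (h ▸ (by norm_num : (2 : ℕ) ∣ 42))
    obtain ⟨V₂, hV₂, ψ, hψc, hψd, -⟩ :=
      φ.exists_isCyclic_degree_eq_of_dvd hφ (d := 21) (h ▸ (by norm_num : (21 : ℕ) ∣ 42))
    haveI := hV₂
    have hmem21 := hT1521 V V₂ ψ hψc (Or.inr hψd)
    rw [hψd] at hmem21
    exact klein_two_ne_of_check (kleinTwoCheck_table _ hmem21 (show (21 : ℕ) ≠ 14 by norm_num))
      ht hj.symm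
  · exact keyPow (L := 21) (m := 9) (by decide) (h ▸ (by norm_num : (21 : ℕ) ∣ 63))
      (h ▸ (by norm_num : (9 : ℕ) ∣ 63))
  · exact keyPow (L := 15) (m := 25) (by decide) (h ▸ (by norm_num : (15 : ℕ) ∣ 75))
      (h ▸ (by norm_num : (25 : ℕ) ∣ 75))
  · -- `273 = 21 · 13`
    obtain ⟨V₂, hV₂, ψL, hψLc, hψLd, -⟩ :=
      φ.exists_isCyclic_degree_eq_of_dvd hφ (d := 21) (h ▸ (by norm_num : (21 : ℕ) ∣ 273))
    obtain ⟨V₃, hV₃, χ, -, hχd, -⟩ :=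
      φ.exists_isCyclic_degree_eq_of_dvd hφ (d := 13) (h ▸ (by norm_num : (13 : ℕ) ∣ 273))
    haveI := hV₂
    haveI := hV₃
    have hT := hT1521 V V₂ ψL hψLc (Or.inr hψLd)
    rw [hψLd] at hT
    exact stub_certThirteenComposite V V₃ χ hχd (lite_jTable_21_27 _ hT (Or.inl rfl))

/-- Door D3 assembled (PROVED): Lemma 6.8 — at EVERY multiplicative place, `v = 2` included —
for every source with an odd pole of `j`, from Cor. 4.4 + row 27 + six levels (+ Klein–Fricke at
`7`, in the tree): NONE of the eight big `j`-tables. -/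
theorem lemma68For_of_oddPole (h44 : Mazur1978.cor44_valuation_j_le_one) (h27 : RowTwentySeven)
    (hL : SixLevels) (hK7 : KleinSeven) (W : WeierstrassCurve ℚ) [W.IsElliptic] (hW : OddPole W) :
    Lemma68For W :=
  lemma68For_of_sourceRadius W le_rfl fun W' _ hiso hmult ↦
    sourceRadius_of_support (R := 163) (by norm_num) ({2, 3, 5, 7, 13} : Finset ℕ) smoothBarrier
      (by decide) smoothBarrier_covers W
      (fun W'' _ χ hχ ↦ smooth_hexcl h27 hL hK7 W W'' χ hχ hmult)
      (fun W'' ψ hψ p hp hpd ↦ support_of_irreducible _ W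
        (irreducible_of_cor44_of_oddPole h44 W hW) ψ hψ hp hpd) W' hiso

/-! ### §D  Door D2 — semistable sources: Serre's dichotomy + Mazur 1977 torsion (NO Cor. 4.4) -/

/-- C1 (PROVED): for a SEMISTABLE `W/ℚ` and a prime `p ∉ {2,3,5,7,13}`, `W[p]`
is irreducible — a stable line `C` is `ℤ/p` or `μ_p` as a Galois module
(`Edixhoven1997_prop_2_1_holds`, PROVED, Serre 1972 §5.4 Prop. 21 / Ribet 1997 Prop. 1); `ℤ/p`
descends to a rational point of order `p` on `W.baseChange ℚ`
(`exists_addOrderOf_eq_of_forall_smul_eq`), `μ_p` gives one on the quotient curve `W/C`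
(`exists_isogeny_ker_eq_and_comp_eq_nsmul_holds`, Weil pairing) — both excluded by
`Mazur1977_no_prime_torsion`.  Template: the tree's
`hasIrreducibleModPGaloisRep_of_isSemistable_of_rational_two_torsion_of_mazur_torsion`
(`RationalTwoTorsionSemistableModPIrreducibleProofs`) with the `2`-torsion hypothesis dropped and
the `13` kept in the exceptional set.  [cite: Mazur1978, Thm 4 (p. 131)] [cite: Mazur1977, Thm (7')] -/
theorem irreducible_of_isSemistable (hMT : NoPrimeTorsion) (W : WeierstrassCurve ℚ) [W.IsElliptic]
    (hW : W.IsSemistable ℤ) (p : ℕ) (hp : p.Prime) (hpS : p ∉ ({2, 3, 5, 7, 13} : Finset ℕ)) :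
    W.HasIrreducibleModPGaloisRep p := by
  haveI : Fact p.Prime := ⟨hp⟩
  haveI : NeZero (p : ℚ) := ⟨Nat.cast_ne_zero.mpr hp.ne_zero⟩
  rcases Edixhoven1997_prop_2_1_holds W hW p hp with hsurj | ⟨H, hstab, hbot, htop, hH⟩
  · exact hasIrreducibleModPGaloisRep_of_hasSurjectiveModNGaloisRep W p hsurj
  exfalso
  -- Mazur 1977: no `Γ_ℚ`-fixed geometric point of order `p` on any `E/ℚ` (Galois descent)
  have hno : ∀ (V : WeierstrassCurve ℚ) [V.IsElliptic] (Q : V.geomPoints), addOrderOf Q = p →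
      (∀ σ : Field.absoluteGaloisGroup ℚ, σ • Q = Q) → False := by
    intro V _ Q hQ hσ
    obtain ⟨Q₀, -, hQ₀⟩ := exists_addOrderOf_eq_of_forall_smul_eq V Q hσ
    exact hMT (V.baseChange ℚ) p hp hpS ⟨Q₀, hQ₀.trans hQ⟩
  /- A generator `s₀` of the stable line `H`. -/
  obtain ⟨s₀, hs₀H, hs₀0, hHeq⟩ := exists_eq_zmultiples_of_ne_bot_of_ne_top W p H hbot htop
  have hs₀0' : (s₀ : W.geomPoints) ≠ 0 := fun h ↦ hs₀0 (Subtype.ext h)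
  have hmemp : ∀ x : geomTorsion W (p : ℤ), p • (x : W.geomPoints) = 0 := fun x ↦ by
    have h := (mem_torsionPoints_iff _ _ (x : W.geomPoints)).mp x.2
    rwa [natCast_zsmul] at h
  have hords₀ : addOrderOf (s₀ : W.geomPoints) = p := addOrderOf_eq_prime (hmemp s₀) hs₀0'
  rcases hH with hfix | hquot
  · /- Case 1: `Γ_ℚ` fixes `H` pointwise: a rational point of order `p` on `E`. -/
    refine hno W s₀ hords₀ fun σ ↦ ?_
    have := hfix σ s₀ hs₀H
    simpa only [AddSubgroup.torsionBy.coe_smul] using congrArg Subtype.val this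
  · /- Case 2: `Γ_ℚ` acts trivially on `E[p]/H`: a rational point of order `p` on `E/H`. -/
    obtain ⟨T₀, hT₀⟩ : ∃ T₀ : geomTorsion W (p : ℤ), T₀ ∉ H := by
      by_contra h
      push Not at h
      exact htop (eq_top_iff.mpr fun x _ ↦ h x)
    set S : AddSubgroup W.geomPoints := H.map (geomTorsion W (p : ℤ)).subtype with hS
    have hSmem : ∀ {x : W.geomPoints}, x ∈ S ↔ ∃ y : geomTorsion W (p : ℤ), y ∈ H ∧ (y : _) = x :=
      fun {x} ↦ by simp only [hS, AddSubgroup.mem_map, AddSubgroup.coe_subtype]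
    have hScard : Nat.card S = p := by
      have hHcard : Nat.card H = p := by
        rw [hHeq, Nat.card_zmultiples, ← AddSubgroup.addOrderOf_coe]
        exact hords₀
      rw [← hHcard]
      exact Nat.card_congr (H.equivMapOfInjective _ (geomTorsion W (p : ℤ)).subtype_injective).symm
    have hSfin : (S : Set W.geomPoints).Finite := by
      have h : Nat.card S ≠ 0 := by rw [hScard]; exact hp.ne_zero
      exact Nat.finite_of_card_ne_zero h
    have hSstab : ∀ (σ : Field.absoluteGaloisGroup ℚ) (x : W.geomPoints), x ∈ S → σ • x ∈ S := by
      intro σ x hx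
      obtain ⟨y, hy, rfl⟩ := hSmem.mp hx
      exact hSmem.mpr ⟨σ • y, hstab σ y hy, rfl⟩
    obtain ⟨W', hW', g, -, hker, -, -⟩ :=
      exists_isogeny_ker_eq_and_comp_eq_nsmul_holds (W := W) S hSfin hSstab
    haveI := hW'
    have hker' : ∀ {x : W.geomPoints}, g x = 0 ↔ x ∈ S := fun {x} ↦ by
      rw [← hker]; rfl
    have hgT0 : g (T₀ : W.geomPoints) ≠ 0 := fun h ↦ by
      obtain ⟨y, hy, hyT⟩ := hSmem.mp (hker'.mp h)
      exact hT₀ (Subtype.ext hyT ▸ hy)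
    have hordgT : addOrderOf (g (T₀ : W.geomPoints)) = p :=
      addOrderOf_eq_prime (by rw [← map_nsmul, hmemp T₀, map_zero]) hgT0
    refine hno W' (g (T₀ : W.geomPoints)) hordgT fun σ ↦ ?_
    -- `σ • T₀ - T₀ ∈ H = ker g`, so `σ • g T₀ = g (σ • T₀) = g T₀`
    have hmem : σ • (T₀ : W.geomPoints) - T₀ ∈ S := by
      refine hSmem.mpr ⟨σ • T₀ - T₀, hquot σ T₀, ?_⟩
      simp only [AddSubgroup.coe_sub, AddSubgroup.torsionBy.coe_smul]
    have h0 : g (σ • (T₀ : W.geomPoints) - T₀) = 0 := hker'.mpr hmem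
    rw [map_sub, sub_eq_zero] at h0
    rw [← g.map_smul, h0]

/-- Door D2 assembled (PROVED modulo `irreducible_of_isSemistable`): Lemma 6.8 for every
SEMISTABLE source, from Mazur 1977 torsion + row 27 + six levels (+ Klein–Fricke at `7`, in the
tree) — no Cor. 4.4, none of the eight big tables.  (The route's Frey clients `freyCurve a b` in
Serre's normalisation are semistable.) -/
theorem lemma68For_of_isSemistable (hMT : NoPrimeTorsion) (h27 : RowTwentySeven) (hL : SixLevels)
    (hK7 : KleinSeven) (W : WeierstrassCurve ℚ) [W.IsElliptic] (hW : W.IsSemistable ℤ) :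
    Lemma68For W :=
  lemma68For_of_sourceRadius W le_rfl fun W' _ hiso hmult ↦
    sourceRadius_of_support (R := 163) (by norm_num) ({2, 3, 5, 7, 13} : Finset ℕ) smoothBarrier
      (by decide) smoothBarrier_covers W
      (fun W'' _ χ hχ ↦ smooth_hexcl h27 hL hK7 W W'' χ hχ hmult)
      (fun W'' ψ hψ p hp hpd ↦ support_of_irreducible _ W
        (irreducible_of_isSemistable hMT W hW) ψ hψ hp hpd) W' hiso

/-! ### §F  Assembly of the verbatim stub -/

/-- **The stub from `h44 + hT8 + hL6` by the source dichotomy** (PROVED modulo `smooth_hexcl`):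
`j(W) ∈ ℤ[1/2]` ⇒ door D1 (tables only); otherwise `j` has an odd pole ⇒ door D3 (Cor. 4.4 only +
row 27 + six levels).  Same bill as Plan A's `stub_of_eight`, but each input is spent on a
disjoint class of sources.  `hK7` (Klein–Fricke at `7`) is DISCHARGED in the tree by
`stub_kleinSevenRat` (`IsogenyGlueCongruenceMazurKenkuBoundStubKleinSevenRat`, `computational`;
not imported here only because that module was unbuilt on the farm snapshot at check time). -/
theorem stub_of_doors (h44 : Mazur1978.cor44_valuation_j_le_one) (hT8 : EightTables)
    (hL : SixLevels) (hK7 : KleinSeven) : PastenShimura2024_lemma_6_8 :=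
  stub_of_forall fun W _ ↦ by
    by_cases hj : OddIntegralJ W
    · exact lemma68For_of_oddIntegral_j (jTables_of_eight hT8 hK7) hL W hj
    · exact lemma68For_of_oddPole h44 (rowTwentySeven_of_eightTables hT8) hL hK7 W
        (oddPole_of_not_oddIntegralJ hj)

/-- What the route actually transports (`stub_valTransport`: the source is `freyCurve a b` at an ODD
conductor prime `q`): for a source with an odd multiplicative place, door D3 alone applies —
`h44 + row 27 + six levels`, no big tables. -/
theorem lemma68For_of_oddMultiplicativePlace (h44 : Mazur1978.cor44_valuation_j_le_one)
    (h27 : RowTwentySeven) (hL : SixLevels) (hK7 : KleinSeven) (W : WeierstrassCurve ℚ) [W.IsElliptic]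
    (hodd : ∃ v : HeightOneSpectrum (𝓞 ℚ), (2 : 𝓞 ℚ) ∉ v.asIdeal ∧ 1 < v.valuation ℚ W.j) :
    Lemma68For W :=
  lemma68For_of_oddPole h44 h27 hL hK7 W (show OddPole W from hodd)

end Summit.ABC.ABC.Cruxes.DefiniteRTControlPrime.StubIdeas3G15
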